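import Summits.RiemannHypothesis.RiemannHypothesis.Theorems.SignConeCondRungPlattTrudgian

/-!
# Route SignCone — Krein–Turán rung, III: the archimedean (prime-free) density and its bounds

Support for the crux `SignConeInequality` (stmt-RiemannHypothesis-16301; plan `Cruxes/SignConeInequality/KREIN-TURAN-RUNG.md`,
Theorem A′). In the Krein–Turán architecture the spectral density carries NO comb: for a Weil test `u` supported in
`[-b′, b′]` (`e^{2b′} < N′ + 1`, plateau kernel `E = d.kernelE ≡ e^{x/2} + e^{−x/2}` on `[-2b′, 2b′]`),
`Re W(u ⋆ ũ) + ‖u‖₂² = (1/2π) ∫ |û(½+iy)|² A(y) dy − Σ_{n ≤ N′} (2Λ(n)/√n) Re (u ⋆ ũ)(log n)`,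
`A(y) = Re ψ(¼ + iy/2) − log π + 1 + Ê(y)` (`IsArchDensity`, `isArchDensity_archDensity`: the landed spectral identity
`slackFunctional_eq_spectralIntegral` with an EMPTY node set, plus `weilPrimeTerm_eq_honest_sum`); the prime sum is kept
as it is and later charged to the Krein–Turán constant. The density obeys the comb-free cases (`M = 0`) of the landed bounds:
`A(y) ≥ log(Y/2) − 2/Y² − π/(2Y) − log π + 1 − C_E/(¼ + Y²)` for `|y| > Y ≥ 1` and `A ≥ −(4.3723 + 4 C_E)` everywhere.
-/

noncomputable section

-- `Summit.RiemannHypothesis.RiemannHypothesis.…` repeats a namespace component by design (D-0017 layout).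
set_option linter.dupNamespace false

open scoped BigOperators ComplexConjugate Real Topology ArithmeticFunction.vonMangoldt
open Complex MeasureTheory Set Filter

namespace Summit.RiemannHypothesis.RiemannHypothesis.Theorems.SignCone

open Literature.NumberTheory.LFunctions Literature.Analysis.SpecialFunctions
open Summit.RiemannHypothesis.RiemannHypothesis.Theorems.SignConeOscillatory (weilConv_weilReflect_add_neg_eq_two_re)

/-- **Arch densities.** `A` represents the prime-free part of the unit-slack Weil functional spectrally at cutoff `b′`,
the prime term being the finite honest node sum over `n ≤ N′`: for every Weil test `u` supported in `[-b′, b′]`,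
`y ↦ |û(½+iy)|² A(y)` is integrable and
`Re W(u ⋆ ũ) + ‖u‖₂² = (1/2π) (∫ |û(½+iy)|² A(y) dy) − Σ_{n ≤ N′} (2Λ(n)/√n) Re (u ⋆ ũ)(log n)` (the node sum is OUTSIDE
the integral). [folklore] -/
def IsArchDensity (b' : ℝ) (N' : ℕ) (A : ℝ → ℝ) : Prop :=
  ∀ u : ℝ → ℂ, IsWeilTest u → tsupport u ⊆ Icc (-b') b' →
    Integrable (fun y : ℝ => ‖weilMellin u (1 / 2 + y * I)‖ ^ 2 * A y) ∧
    (weilFunctional (weilConv u (weilReflect u))).re + weilNorm2Sq u =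
      1 / (2 * π) * (∫ y : ℝ, ‖weilMellin u (1 / 2 + y * I)‖ ^ 2 * A y) -
        ∑ n ∈ Finset.range (N' + 1), 2 * Λ n / Real.sqrt n * ((weilConv u (weilReflect u)) (Real.log n)).re

/-- The archimedean density `A(y) = Re ψ(¼ + iy/2) − log π + 1 + Ê_χ(y)` of the plateau kernel `d`. [folklore] -/
def archDensity (d : PWKernel) (y : ℝ) : ℝ :=
  reDigammaQuarter y - Real.log π + 1 + cosTransform d.kernelE y

/-- The honest comb with no nodes vanishes (`Λ(0) = 0`). [folklore] -/
theorem honestComb_zero (y : ℝ) : honestComb 0 y = 0 := by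
  simp [honestComb]

/-- `A = F⁺` with `N′ = 0` honest nodes and the empty SOS datum. [folklore] -/
theorem archDensity_eq_honestDensity (d : PWKernel) (y : ℝ) : archDensity d y = honestDensity d 0 crSOS y := by
  rw [honestDensity, honestComb_zero, crSOS_Hsos, archDensity]; ring

section Represent

variable {b' : ℝ} {d : PWKernel} (hdh : 0 < d.h) (hdL : (d.L : ℝ) = 2 * b') {N' : ℕ} (hN : Real.exp (2 * b') < N' + 1)
include hdh hdL hN

/-- **The archimedean density is an arch density at cutoff `b′`** (with `N′` honest nodes, `e^{2b′} < N′ + 1`). [folklore] -/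
theorem isArchDensity_archDensity : IsArchDensity b' N' (archDensity d) := by
  intro u hu hus
  have hUt : IsWeilTest (weilConv u (weilReflect u)) := hu.weilConv hu.weilReflect
  have hUs : tsupport (weilConv u (weilReflect u)) ⊆ Icc (-(2 * b')) (2 * b') :=
    tsupport_weilConv_weilReflect_subset hu.2 hus
  have hEc := d.continuous_kernelE
  have hEs := d.hasCompactSupport_kernelE hdh
  have hEeq : ∀ x ∈ Icc (-(2 * b')) (2 * b'), d.kernelE x = Real.exp (x / 2) + Real.exp (-(x / 2)) := by
    have := d.kernelE_eq_on_Icc hdh; rwa [hdL] at this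
  -- integrability: |A| ≤ A₀ + 27 y²
  set A₀ : ℝ := |reDigammaQuarter 0| + |Real.log π| + 1 + (∫ x, |d.kernelE x|) with hA₀
  have hA0 : 0 ≤ A₀ := by
    have : 0 ≤ ∫ x, |d.kernelE x| := integral_nonneg fun _ => abs_nonneg _
    positivity
  have hbound : ∀ y, |archDensity d y| ≤ A₀ + 27 * y ^ 2 := by
    intro y
    have h1 := abs_reDigammaQuarter_le y
    have h2 := abs_cosTransform_le hEc hEs y
    unfold archDensity
    rw [abs_le] at h1 h2 ⊢
    have h5 := abs_le.1 (le_refl |Real.log π|)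
    constructor <;> nlinarith [h1.1, h1.2, h2.1, h2.2, h5.1, h5.2, sq_nonneg y]
  have hmeas : Measurable (archDensity d) := by
    have e : archDensity d = honestDensity d 0 crSOS := funext (archDensity_eq_honestDensity d)
    rw [e]; exact (continuous_honestDensity (N' := 0) (Z := crSOS) hdh (d := d)).measurable
  have hint : Integrable fun y : ℝ => ‖weilMellin u (1 / 2 + y * I)‖ ^ 2 * archDensity d y :=
    integrable_norm_sq_weilMellin_mul hu hmeas hA0 (by norm_num) hbound
  refine ⟨hint, ?_⟩
  -- the identity with an empty node set
  have hid := slackFunctional_eq_spectralIntegral hu hus hEc hEs hEeq 1 ∅ (fun _ => 0)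
  simp only [Finset.sum_empty, sub_zero, one_mul] at hid
  have hW : (weilFunctional (weilConv u (weilReflect u))).re =
      (weilPolarTerm (weilConv u (weilReflect u)) + weilArchTerm (weilConv u (weilReflect u))).re -
      ∑ n ∈ Finset.range (N' + 1), 2 * Λ n / Real.sqrt n * (weilConv u (weilReflect u) (Real.log n)).re := by
    rw [weilFunctional, weilPrimeTerm_eq_honest_sum hN hUt.1.continuous hUs]
    have e : ∀ n : ℕ, ((((2 * Λ n / Real.sqrt n) / 2 : ℝ) : ℂ) *
        (weilConv u (weilReflect u) (Real.log n) + weilConv u (weilReflect u) (-Real.log n))).re =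
        2 * Λ n / Real.sqrt n * (weilConv u (weilReflect u) (Real.log n)).re := fun n => by
      rw [weilConv_weilReflect_add_neg_eq_two_re, ← Complex.ofReal_mul, Complex.ofReal_re]; ring
    rw [Complex.add_re, Complex.sub_re, Complex.re_sum, Complex.add_re]
    simp only [e]
    ring
  rw [hW]
  unfold archDensity
  linarith [hid]

end Represent

/-! ### High- and low-frequency bounds of the archimedean density -/

section Bounds

variable {d : PWKernel} (hdL0 : 0 ≤ d.L) (hdh : 0 < d.h)
include hdL0 hdh

/-- **Low band**: `A(y) ≥ −(4.3723 + 4 C_E)` for every `y`. [folklore] -/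
theorem archDensity_lowBand (y : ℝ) : -(4.3723 + 4 * d.decayConst) ≤ archDensity d y := by
  have hcomb : ∀ y : ℝ, honestComb 0 y - crSOS.Hsos y ≤ 0 := fun y => by
    rw [honestComb_zero, crSOS_Hsos, sub_zero]
  have := honestDensity_lowBand hdL0 hdh hcomb y
  rw [archDensity_eq_honestDensity]
  linarith

/-- **High frequencies**: for `|y| > Y ≥ 1`, `A(y) ≥ log(Y/2) − 2/Y² − π/(2Y) − log π + 1 − C_E/(¼ + Y²)`. [folklore] -/
theorem archDensity_highFreq {Y : ℝ} (hY : 1 ≤ Y) {y : ℝ} (hy : Y < |y|) :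
    Real.log (Y / 2) - 2 / Y ^ 2 - π / (2 * Y) - Real.log π + 1 - d.decayConst / (1 / 4 + Y ^ 2) ≤
      archDensity d y := by
  have hcomb : ∀ y : ℝ, honestComb 0 y - crSOS.Hsos y ≤ 0 := fun y => by
    rw [honestComb_zero, crSOS_Hsos, sub_zero]
  have := honestDensity_highFreq hdL0 hdh hcomb hY hy
  rw [archDensity_eq_honestDensity]
  linarith

end Bounds

end Summit.RiemannHypothesis.RiemannHypothesis.Theorems.SignCone

end
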